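import Mathlib.Tactic
import HarnessLib
import HarnessLib.Audit.Tags
import Summits.CriticalPhenomena.PercolationContinuityZ3.Theorems.PercNearOneGluingNoHeavyLowerTailSahiRainbowMax

/-!
# The max-antichain accounting: at most two hard members

Support file (seat `prim-masterthm-p1`, gen 39; `--supports stmt-CriticalPhenomena-4575`).  Unconditional theorems, no new definitions, no
`sorry`, standard axioms.  Memo `run/shared/lean/prim/prim-masterthm/FROM-prim-masterthm-p1-g39-MAX-ACCOUNTING.md` §2, §7.

SETTING (`…SahiRainbowMax`): `A ⊆ 2^F` complement-free antichain, `availColours F A X`, `hardMembers F P`, and the accounting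
`card_le_card_rainbowMeets_of_avail`: RAINBOW(P) as soon as `#hardMembers F P ≤ #availColours F (maxMembers P) (hardMembers F P)`.

NEW HERE ([this work], gen 39): the Hall inequality `#X ≤ #availColours F A X` for `#X ≤ 2` (`AntichainAvailHall` in its first two cases),
unconditionally.
* `empty_mem_availColours`: `∅` is available to every non-empty admissible `X`.
* `exists_ne_empty_mem_availColours_pair`: two admissible members `x ≠ y` always have a NON-EMPTY available colour — their meet if it is not
  blocked; if it is blocked by `e = F \ (x ∩ y) ∈ A`, the eater's trace `e ∩ x = x \ y` (its complement would contain `y`, making `y` a blocker);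
  if `x ∩ y = ∅`, the complemented join `F \ (x ∪ y)` when no member strictly contains it, and otherwise a trace `b ∩ x` or `b ∩ y` of a member
  `b` strictly containing it (again its complement would contain the other member).
* `card_le_card_availColours_of_card_le_two`: hence `#X ≤ #availColours F A X` whenever `#X ≤ 2`.
* **`card_le_card_rainbowMeets_of_card_hardMembers_le_two`** (UNCONDITIONAL): every complement-free family with at most two hard members
  (maximal members that are minimal in `P` and whose complement is not a colour of the maximal antichain) satisfies the rainbow lemma.  This
  extends `card_le_card_rainbowMeets_of_card_isoMembers_le_one` (gen 34: at most one isolated member) — hard members are isolated, and isolated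
  blockers are not hard.  On `2^5`, 94.0 % of the 43 046 720 complement-free families have NO hard member (`code-g39/coverage.c`).
HONEST FRAMING: unconditional; the general case (`AntichainAvailHall`) remains OPEN. [this work]
-/

namespace Summit.CriticalPhenomena.PercolationContinuityZ3.Theorems.SahiColouredDaykin

open Finset

variable {α : Type*} [DecidableEq α]

section Two

variable {F : Finset α} {A X : Finset (Finset α)}

/-- `F` is not a member when some member has its complement outside the colours (the complement of `F` is the colour `∅`). [this work] -/
theorem top_not_mem_of_admissible {x : Finset α} (hx : x ∈ A) (hσx : F \ x ∉ rainbowMeets F A)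
    (hanti : IsAntichain (· ⊆ ·) (A : Set (Finset α))) (hAF : ∀ a ∈ A, a ⊆ F) : F ∉ A := by
  intro hF
  by_cases hxF : x = F
  · subst hxF; rw [sdiff_self] at hσx; exact hσx (mem_rainbowMeets_iff.2 (Or.inl rfl))
  · exact hanti (mem_coe.2 hx) (mem_coe.2 hF) hxF (hAF x hx)

/-- **`∅` is available** to every non-empty admissible `X`. [this work] -/
theorem empty_mem_availColours (hAF : ∀ a ∈ A, a ⊆ F) (hanti : IsAntichain (· ⊆ ·) (A : Set (Finset α))) (hXA : X ⊆ A)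
    (hX : ∀ x ∈ X, F \ x ∉ rainbowMeets F A) {x : Finset α} (hx : x ∈ X) : (∅ : Finset α) ∈ availColours F A X := by
  refine mem_availColours_iff.2 ⟨mem_rainbowMeets_iff.2 (Or.inl rfl), ?_, ?_⟩
  · rw [sdiff_empty]; exact top_not_mem_of_admissible (hXA hx) (hX x hx) hanti hAF
  · by_cases hx0 : x = ∅
    · -- then `x = ∅` is the only member of the antichain
      left
      intro a ha hlt
      have : a = x := by
        by_contra hne
        exact hanti (mem_coe.2 (hXA hx)) (mem_coe.2 ha) (Ne.symm hne) (hx0 ▸ empty_subset a)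
      rw [this, hx0] at hlt
      exact (Finset.ssubset_iff_subset_ne.1 hlt).2 rfl
    · exact Or.inr ⟨x, hx, Finset.empty_ssubset.2 (nonempty_iff_ne_empty.2 hx0)⟩

/-- A trace `b ∩ x` of a member `b` on an admissible member `x`, disjoint from another admissible member `y`, is an available colour of
`{x, y}`: its complement contains `y`, so it cannot be a member (that member would be `y`, a blocker). [this work] -/
theorem inter_mem_availColours_pair {x y b : Finset α} (hAF : ∀ a ∈ A, a ⊆ F) (hanti : IsAntichain (· ⊆ ·) (A : Set (Finset α)))
    (hx : x ∈ A) (hy : y ∈ A) (hb : b ∈ A) (hbx : b ≠ x) (hσy : F \ y ∉ rainbowMeets F A)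
    (hdisj : y ∩ (b ∩ x) = ∅) : b ∩ x ∈ availColours F A {x, y} := by
  have hR : b ∩ x ∈ rainbowMeets F A := inter_mem_rainbowMeets hb hx hbx
  refine mem_availColours_iff.2 ⟨hR, fun hc => ?_, Or.inr ⟨x, mem_insert_self _ _, ?_⟩⟩
  · -- `c = F \ (b ∩ x) ∈ A` contains `y`, hence equals `y`, and then `F \ y = b ∩ x` is a colour
    have hyc : y ⊆ F \ (b ∩ x) := fun z hz => mem_sdiff.2 ⟨hAF y hy hz, fun hz' => by
      have : z ∈ y ∩ (b ∩ x) := mem_inter.2 ⟨hz, hz'⟩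
      rw [hdisj] at this; exact notMem_empty _ this⟩
    have hyeq : y = F \ (b ∩ x) := by
      by_contra hne'
      exact hanti (mem_coe.2 hy) (mem_coe.2 hc) hne' hyc
    apply hσy
    rw [hyeq, Finset.sdiff_sdiff_eq_self (inter_subset_right.trans (hAF x hx))]
    exact hR
  · refine Finset.ssubset_iff_subset_ne.2 ⟨inter_subset_right, fun e => ?_⟩
    exact hanti (mem_coe.2 hx) (mem_coe.2 hb) hbx.symm (inter_eq_right.1 e)

/-- **Two admissible members have a non-empty available colour.** [this work] -/
theorem exists_ne_empty_mem_availColours_pair {x y : Finset α} (hAF : ∀ a ∈ A, a ⊆ F) (hcf : ∀ a ∈ A, F \ a ∉ A)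
    (hanti : IsAntichain (· ⊆ ·) (A : Set (Finset α))) (hx : x ∈ A) (hy : y ∈ A) (hxy : x ≠ y)
    (hσx : F \ x ∉ rainbowMeets F A) (hσy : F \ y ∉ rainbowMeets F A) :
    ∃ t ∈ availColours F A {x, y}, t ≠ ∅ := by
  have hxF := hAF x hx
  have hyF := hAF y hy
  by_cases hm : x ∩ y = ∅
  · -- disjoint members: look at the complemented join
    set t₀ := F \ (x ∪ y) with ht₀
    have ht₀R : t₀ ∈ rainbowMeets F A := sdiff_union_mem_rainbowMeets hx hy hxy
    have ht₀ne : t₀ ≠ ∅ := by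
      intro h0
      -- then `x ∪ y = F` and `x ∩ y = ∅`: `y = F \ x`
      apply hcf x hx
      have e : F \ x = y := by
        ext z; rw [mem_sdiff]; constructor
        · rintro ⟨hzF, hzx⟩
          by_contra hzy
          have : z ∈ t₀ := mem_sdiff.2 ⟨hzF, fun h => (mem_union.1 h).elim hzx hzy⟩
          rw [h0] at this; exact notMem_empty _ this
        · intro hz
          exact ⟨hyF hz, fun hzx => by
            have : z ∈ x ∩ y := mem_inter.2 ⟨hzx, hz⟩
            rw [hm] at this; exact notMem_empty _ this⟩
      rw [e]; exact hy
    have hσt₀ : F \ t₀ ∉ A := by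
      rw [ht₀, Finset.sdiff_sdiff_eq_self (union_subset hxF hyF)]
      intro hw
      have hne : x ≠ x ∪ y := by
        intro e
        have : y ⊆ x := by rw [e]; exact subset_union_right
        exact hanti (mem_coe.2 hy) (mem_coe.2 hx) hxy.symm this
      exact hanti (mem_coe.2 hx) (mem_coe.2 hw) hne subset_union_left
    by_cases hsafe : ∀ a ∈ A, ¬ t₀ ⊂ a
    · exact ⟨t₀, mem_availColours_iff.2 ⟨ht₀R, hσt₀, Or.inl hsafe⟩, ht₀ne⟩
    · push Not at hsafe
      obtain ⟨b, hb, htb⟩ := hsafe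
      -- `b` meets `x` or `y`
      have hbx_or : b ∩ x ≠ ∅ ∨ b ∩ y ≠ ∅ := by
        by_contra hboth
        push Not at hboth
        obtain ⟨h1, h2⟩ := hboth
        -- then `b ⊆ t₀`, contradicting `t₀ ⊂ b`
        have hbt : b ⊆ t₀ := by
          intro z hz
          refine mem_sdiff.2 ⟨hAF b hb hz, fun hzu => ?_⟩
          rcases mem_union.1 hzu with hzx | hzy
          · have : z ∈ b ∩ x := mem_inter.2 ⟨hz, hzx⟩
            rw [h1] at this; exact notMem_empty _ this
          · have : z ∈ b ∩ y := mem_inter.2 ⟨hz, hzy⟩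
            rw [h2] at this; exact notMem_empty _ this
        exact (Finset.ssubset_iff_subset_ne.1 htb).2 (Subset.antisymm htb.1 hbt)
      have hbx : b ≠ x := by
        rintro rfl
        obtain ⟨z, hz⟩ := nonempty_iff_ne_empty.2 ht₀ne
        have hzb : z ∈ b := htb.1 hz
        rw [ht₀] at hz
        exact (mem_sdiff.1 hz).2 (mem_union_left _ hzb)
      have hby : b ≠ y := by
        rintro rfl
        obtain ⟨z, hz⟩ := nonempty_iff_ne_empty.2 ht₀ne
        have hzb : z ∈ b := htb.1 hz
        rw [ht₀] at hz
        exact (mem_sdiff.1 hz).2 (mem_union_right _ hzb)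
      rcases hbx_or with h1 | h2
      · refine ⟨b ∩ x, inter_mem_availColours_pair hAF hanti hx hy hb hbx hσy ?_, h1⟩
        rw [← inter_assoc, inter_comm y b, inter_assoc, inter_comm y x, hm, inter_empty]
      · refine ⟨b ∩ y, ?_, h2⟩
        rw [pair_comm]
        refine inter_mem_availColours_pair hAF hanti hy hx hb hby hσx ?_
        rw [← inter_assoc, inter_comm x b, inter_assoc, hm, inter_empty]
  · -- the meet is non-empty
    by_cases hbl : F \ (x ∩ y) ∈ A
    · -- blocked by `e = F \ (x ∩ y)`: use the eater's trace `e ∩ x = x \ y`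
      set e := F \ (x ∩ y) with he
      have hex : e ≠ x := by
        intro h
        have : x ∩ y ⊆ e := by rw [h]; exact inter_subset_left
        obtain ⟨z, hz⟩ := nonempty_iff_ne_empty.2 hm
        exact (mem_sdiff.1 (this hz)).2 hz
      have hne : e ∩ x ≠ ∅ := by
        intro h0
        -- `e ∩ x = x \ y = ∅` gives `x ⊆ y`
        apply hanti (mem_coe.2 hx) (mem_coe.2 hy) hxy
        intro z hz
        by_contra hzy
        have : z ∈ e ∩ x := mem_inter.2 ⟨mem_sdiff.2 ⟨hxF hz, fun h => hzy (mem_inter.1 h).2⟩, hz⟩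
        rw [h0] at this; exact notMem_empty _ this
      refine ⟨e ∩ x, inter_mem_availColours_pair hAF hanti hx hy hbl hex hσy ?_, hne⟩
      ext z
      constructor
      · intro hz
        obtain ⟨hzy, hzex⟩ := mem_inter.1 hz
        obtain ⟨hze, hzx⟩ := mem_inter.1 hzex
        rw [he] at hze
        exact absurd (mem_inter.2 ⟨hzx, hzy⟩) (mem_sdiff.1 hze).2
      · intro hz
        exact absurd hz (notMem_empty z)
    · refine ⟨x ∩ y, mem_availColours_iff.2 ⟨inter_mem_rainbowMeets hx hy hxy, hbl, Or.inr ⟨x, mem_insert_self _ _, ?_⟩⟩, hm⟩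
      refine Finset.ssubset_iff_subset_ne.2 ⟨inter_subset_left, fun e => ?_⟩
      exact hanti (mem_coe.2 hx) (mem_coe.2 hy) hxy (inter_eq_left.1 e)

/-- **The Hall inequality for at most two members.** [this work] -/
theorem card_le_card_availColours_of_card_le_two (hAF : ∀ a ∈ A, a ⊆ F) (hcf : ∀ a ∈ A, F \ a ∉ A)
    (hanti : IsAntichain (· ⊆ ·) (A : Set (Finset α))) (hXA : X ⊆ A) (hX : ∀ x ∈ X, F \ x ∉ rainbowMeets F A)
    (h2 : #X ≤ 2) : #X ≤ #(availColours F A X) := by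
  rcases Nat.lt_or_ge #X 1 with h0 | h1
  · have : #X = 0 := by omega
    rw [this]; exact Nat.zero_le _
  rcases Nat.lt_or_ge #X 2 with hlt | hge
  · -- one member: `∅` pays
    have h1' : #X = 1 := by omega
    obtain ⟨x, hXx⟩ := card_eq_one.1 h1'
    have hx : x ∈ X := by rw [hXx]; exact mem_singleton_self x
    rw [h1']
    exact card_pos.2 ⟨∅, empty_mem_availColours hAF hanti hXA hX hx⟩
  · -- two members
    have h2' : #X = 2 := by omega
    obtain ⟨x, y, hxy, hXxy⟩ := card_eq_two.1 h2'
    have hx : x ∈ X := by rw [hXxy]; exact mem_insert_self _ _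
    have hy : y ∈ X := by rw [hXxy]; exact mem_insert_of_mem (mem_singleton_self y)
    obtain ⟨t, ht, htne⟩ := exists_ne_empty_mem_availColours_pair hAF hcf hanti (hXA hx) (hXA hy) hxy (hX x hx) (hX y hy)
    rw [← hXxy] at ht
    have h0 : (∅ : Finset α) ∈ availColours F A X := empty_mem_availColours hAF hanti hXA hX hx
    rw [h2']
    have : ({∅, t} : Finset (Finset α)) ⊆ availColours F A X := by
      intro s hs
      rcases mem_insert.1 hs with rfl | hs
      · exact h0
      · rw [mem_singleton.1 hs]; exact ht
    calc 2 = #({∅, t} : Finset (Finset α)) := by rw [card_pair htne.symm]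
      _ ≤ #(availColours F A X) := card_le_card this

end Two

/-- **The rainbow lemma for families with at most two hard members** (unconditional). [this work] -/
theorem card_le_card_rainbowMeets_of_card_hardMembers_le_two {F : Finset α} {P : Finset (Finset α)}
    (hPF : ∀ S ∈ P, S ⊆ F) (hcf : ∀ S ∈ P, F \ S ∉ P) (h2 : #(hardMembers F P) ≤ 2) :
    #P ≤ #(rainbowMeets F P) := by
  have hAP := maxMembers_subset P
  exact card_le_card_rainbowMeets_of_avail hPF hcf
    (card_le_card_availColours_of_card_le_two (fun a ha => hPF a (hAP ha)) (fun a ha h' => hcf a (hAP ha) (hAP h'))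
      (isAntichain_maxMembers P) (hardMembers_subset F P) (fun x hx => (mem_hardMembers_iff.1 hx).2.2) h2)

end Summit.CriticalPhenomena.PercolationContinuityZ3.Theorems.SahiColouredDaykin
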